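import Summits.Ventures.CertifiedArithmetic.Expansions.Orient2dStageC
import Summits.Ventures.CertifiedArithmetic.Expansions.Orient2dStageB
import Summits.Ventures.CertifiedArithmetic.Expansions.Orient2dPredicates
import Mathlib.Tactic.Linarith
import Mathlib.Tactic.NormNum

/-!
# ORIENT2D end to end: `predicates.c`'s adaptive predicate never returns a wrong strict sign

NEW WORK in the sense of this development (the algorithm is Shewchuk's `orient2d` + `orient2dadapt`
of `predicates.c`, Fig. 21 and Table 1 of [Shewchuk1997]; the statement in this model and its proof
are ours — the capstone of `Orient2dStageA` (Literature), `Orient2dStageB`, `Orient2dEstimate`,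
`Orient2dStageC` and `Orient2dPredicates`).

* `orient2dAdapt` — the WHOLE adaptive predicate as one function: stage A (`orient2dStageA`, filter
  `ccwerrboundA ⊗ detsum`); else stage B (`orient2dStageB`); else, if the four TWO-DIFF tails vanish,
  return stage B's `det`; else stage C (`orient2dStageC`); else the last component of the exact
  expansion `D` of stage D computed with `predicates.c`'s own `fast_expansion_sum_zeroelim`
  (`orient2dExactWith (fastExpansionSumZeroElimC fl)`), over a rounding `fl`, a two-product `tp`
  and the four published coefficients.
* `orient2dAdapt_sign` — **a nonzero answer has the sign of the TRUE determinant**: for `p ≥ 4`,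
  `fl` any round-to-nearest into `F(p, emin)` that is odd and has the `RoundoffBelow 2` property
  (ties-to-even, ties-away), `tp` error-free on `F(p, e₀)`, the coordinates in `F(p, e₀)` with
  `emin ≤ e₀` and `emin + 3p ≤ 2e₀`, and the coefficients `ccwerrboundA/B/C`, `resulterrbound` of
  Table 1: `r > 0 → t_A > 0` and `r < 0 → t_A < 0`; `orient2dAdapt_sign_iff`: if `r ≠ 0` both are
  equivalences.  `orient2dAdapt_fma_sign`: the instance ties-to-even + `2Prod_FMA`.

WHAT `r = 0` MEANS (honest): stage A answers `0` iff `t_A = 0` and stage D answers `0` iff `t_A = 0`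
(`orient2dStageA_correct`, `orient2dExactWith_sign`); stages B and C never answer `0`; the
tails-zero exit CAN a priori answer `0` — `Orient2dEstimateZero` shows such a `0` hides at most half
an ulp of the leading block component and conjecturally never a nonzero determinant (NOT proved).
So the theorem below is the full specification of `orient2d` EXCEPT for a `0` returned at the
tails-zero exit.  Other caveats as in the stage files: no overflow model; the format hypothesis
excludes the gradual-underflow range (binary64: coordinates multiples of `2^−457`).

References: J. R. Shewchuk, Discrete Comput. Geom. 18 (1997) 305–363, §4.3, Fig. 21, Table 1, and
`predicates.c` [Shewchuk1997].
-/

namespace Summit.Ventures.CertifiedArithmetic.Expansions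

open Literature.ComputerArithmetic.JeannerodRump2018
open Literature.ComputerArithmetic.BoldoJeannerodMelquiondMuller2023 hiding twoSum twoSum_fst isFloat_twoSum
open Literature.ComputerArithmetic.Shewchuk1997

variable {p : ℕ} {emin : ℤ} {fl : ℚ → ℚ}

/-! ## The adaptive predicate as one function -/

/-- **`orient2d` of `predicates.c`** (stage A in `orient2d`, stages B–D in `orient2dadapt`) over a
rounding `fl`, a two-product `tp`, an expansion-sum routine `fes` for stage D and the coefficients
`KA = ccwerrboundA`, `KB = ccwerrboundB`, `KC = ccwerrboundC`, `KR = resulterrbound`.  The TWO-DIFF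
tails are the exact ones (`twoDiff_exact`); stage D's expansion is nonempty (`FesSpec`), its last
component is read with default `0`. -/
def orient2dAdapt (fes : List ℚ → List ℚ → List ℚ) (tp : ℚ → ℚ → ℚ × ℚ) (fl : ℚ → ℚ)
    (KA KB KC KR : ℚ) (a₁ a₂ b₁ b₂ c₁ c₂ : ℚ) : ℚ :=
  match orient2dStageA fl KA a₁ a₂ b₁ b₂ c₁ c₂ with
  | some d => d
  | none =>
    match orient2dStageB tp fl KB (orient2dDetsum fl a₁ a₂ b₁ b₂ c₁ c₂) a₁ a₂ b₁ b₂ c₁ c₂ with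
    | some d => d
    | none =>
      if (a₁ - c₁) - fl (a₁ - c₁) = 0 ∧ (b₂ - c₂) - fl (b₂ - c₂) = 0 ∧ (a₂ - c₂) - fl (a₂ - c₂) = 0 ∧
          (b₁ - c₁) - fl (b₁ - c₁) = 0 then
        orient2dDetB tp fl a₁ a₂ b₁ b₂ c₁ c₂
      else
        match orient2dStageC tp fl KC KR (orient2dDetsum fl a₁ a₂ b₁ b₂ c₁ c₂) a₁ a₂ b₁ b₂ c₁ c₂ with
        | some d => d
        | none => ((orient2dExactWith fes tp fl a₁ a₂ b₁ b₂ c₁ c₂).getLast?).getD 0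

section equations

variable {fes : List ℚ → List ℚ → List ℚ} {tp : ℚ → ℚ → ℚ × ℚ} {KA KB KC KR a₁ a₂ b₁ b₂ c₁ c₂ : ℚ}

/-- Stage A answered: the predicate returns stage A's `det`. -/
theorem orient2dAdapt_of_stageA {d : ℚ} (hA : orient2dStageA fl KA a₁ a₂ b₁ b₂ c₁ c₂ = some d) :
    orient2dAdapt fes tp fl KA KB KC KR a₁ a₂ b₁ b₂ c₁ c₂ = d := by
  simp [orient2dAdapt, hA]

/-- Stage A fell through and stage B answered: the predicate returns stage B's `det`. -/
theorem orient2dAdapt_of_stageB (hA : orient2dStageA fl KA a₁ a₂ b₁ b₂ c₁ c₂ = none) {d : ℚ}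
    (hB : orient2dStageB tp fl KB (orient2dDetsum fl a₁ a₂ b₁ b₂ c₁ c₂) a₁ a₂ b₁ b₂ c₁ c₂ = some d) :
    orient2dAdapt fes tp fl KA KB KC KR a₁ a₂ b₁ b₂ c₁ c₂ = d := by
  simp [orient2dAdapt, hA, hB]

/-- Stages A and B fell through and the four tails vanish: the predicate returns stage B's `det`
(`= orient2dDetB`). -/
theorem orient2dAdapt_of_tailsZero (hA : orient2dStageA fl KA a₁ a₂ b₁ b₂ c₁ c₂ = none)
    (hB : orient2dStageB tp fl KB (orient2dDetsum fl a₁ a₂ b₁ b₂ c₁ c₂) a₁ a₂ b₁ b₂ c₁ c₂ = none)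
    (hT : (a₁ - c₁) - fl (a₁ - c₁) = 0 ∧ (b₂ - c₂) - fl (b₂ - c₂) = 0 ∧ (a₂ - c₂) - fl (a₂ - c₂) = 0 ∧
      (b₁ - c₁) - fl (b₁ - c₁) = 0) :
    orient2dAdapt fes tp fl KA KB KC KR a₁ a₂ b₁ b₂ c₁ c₂ = orient2dDetB tp fl a₁ a₂ b₁ b₂ c₁ c₂ := by
  simp [orient2dAdapt, hA, hB, hT]

/-- Stages A, B and the tails-zero exit fell through and stage C answered: the predicate returns
stage C's `det`. -/
theorem orient2dAdapt_of_stageC (hA : orient2dStageA fl KA a₁ a₂ b₁ b₂ c₁ c₂ = none)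
    (hB : orient2dStageB tp fl KB (orient2dDetsum fl a₁ a₂ b₁ b₂ c₁ c₂) a₁ a₂ b₁ b₂ c₁ c₂ = none)
    (hT : ¬((a₁ - c₁) - fl (a₁ - c₁) = 0 ∧ (b₂ - c₂) - fl (b₂ - c₂) = 0 ∧ (a₂ - c₂) - fl (a₂ - c₂) = 0 ∧
      (b₁ - c₁) - fl (b₁ - c₁) = 0)) {d : ℚ}
    (hC : orient2dStageC tp fl KC KR (orient2dDetsum fl a₁ a₂ b₁ b₂ c₁ c₂) a₁ a₂ b₁ b₂ c₁ c₂ = some d) :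
    orient2dAdapt fes tp fl KA KB KC KR a₁ a₂ b₁ b₂ c₁ c₂ = d := by
  simp [orient2dAdapt, hA, hB, hT, hC]

/-- Everything fell through: the predicate returns the last component of stage D's expansion. -/
theorem orient2dAdapt_of_stageD (hA : orient2dStageA fl KA a₁ a₂ b₁ b₂ c₁ c₂ = none)
    (hB : orient2dStageB tp fl KB (orient2dDetsum fl a₁ a₂ b₁ b₂ c₁ c₂) a₁ a₂ b₁ b₂ c₁ c₂ = none)
    (hT : ¬((a₁ - c₁) - fl (a₁ - c₁) = 0 ∧ (b₂ - c₂) - fl (b₂ - c₂) = 0 ∧ (a₂ - c₂) - fl (a₂ - c₂) = 0 ∧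
      (b₁ - c₁) - fl (b₁ - c₁) = 0))
    (hC : orient2dStageC tp fl KC KR (orient2dDetsum fl a₁ a₂ b₁ b₂ c₁ c₂) a₁ a₂ b₁ b₂ c₁ c₂ = none) :
    orient2dAdapt fes tp fl KA KB KC KR a₁ a₂ b₁ b₂ c₁ c₂ =
      ((orient2dExactWith fes tp fl a₁ a₂ b₁ b₂ c₁ c₂).getLast?).getD 0 := by
  simp [orient2dAdapt, hA, hB, hT, hC]

end equations

/-! ## The main theorem -/

/-- **`orient2d` NEVER RETURNS A WRONG STRICT SIGN.**  Let `p ≥ 4`, `fl` any round-to-nearest into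
`F(p, emin)` that is odd and has the `RoundoffBelow 2` property, `fes` an expansion-sum routine
meeting `FesSpec` (both tree versions do), `tp` error-free on `F(p, e₀)`, and the six coordinates
floats of `F(p, e₀)` with `emin ≤ e₀`, `emin + 3p ≤ 2e₀`.  With the published coefficients, the
answer `r` of the adaptive predicate satisfies `r > 0 → t_A > 0` and `r < 0 → t_A < 0` for the TRUE
determinant `t_A = (a₁ − c₁)(b₂ − c₂) − (a₂ − c₂)(b₁ − c₁)`. -/
theorem orient2dAdapt_sign (hp : 4 ≤ p) (hfl : IsRoundNearest p emin fl)
    (hodd : ∀ t, fl (-t) = -fl t) (hfl2 : RoundoffBelow 2 fl)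
    {fes : List ℚ → List ℚ → List ℚ} (hfes : FesSpec p emin fes) {e₀ : ℤ} (he₀ : emin ≤ e₀)
    (h3 : emin + 3 * p ≤ e₀ + e₀) {tp : ℚ → ℚ → ℚ × ℚ}
    (htp : ∀ x y, IsFloat p e₀ x → IsFloat p e₀ y → ExactTwoProd p emin fl tp x y)
    {a₁ a₂ b₁ b₂ c₁ c₂ : ℚ} (ha₁ : IsFloat p e₀ a₁) (ha₂ : IsFloat p e₀ a₂) (hb₁ : IsFloat p e₀ b₁)
    (hb₂ : IsFloat p e₀ b₂) (hc₁ : IsFloat p e₀ c₁) (hc₂ : IsFloat p e₀ c₂) :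
    (0 < orient2dAdapt fes tp fl (ccwerrboundA p) (ccwerrboundB p) (ccwerrboundC p)
        (resulterrbound p) a₁ a₂ b₁ b₂ c₁ c₂ → 0 < orient2dDet a₁ a₂ b₁ b₂ c₁ c₂) ∧
      (orient2dAdapt fes tp fl (ccwerrboundA p) (ccwerrboundB p) (ccwerrboundC p)
        (resulterrbound p) a₁ a₂ b₁ b₂ c₁ c₂ < 0 → orient2dDet a₁ a₂ b₁ b₂ c₁ c₂ < 0) := by
  have hp1 : 1 ≤ p := le_trans (by norm_num) hp
  have h2 : emin + 2 * p ≤ e₀ + e₀ := by omega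
  unfold orient2dDet
  -- the rounded differences are floats of `F(p, e₀)`, so `tp` is error-free on them
  have fmt : ∀ {x y : ℚ}, IsFloat p e₀ x → IsFloat p e₀ y → IsFloat p e₀ (fl (x - y)) :=
    fun hx hy => isFloat_of_isFloat_of_onGrid (hfl _).1
      (((OnGrid.of_isFloat hx).sub (OnGrid.of_isFloat hy)).fl_of hp1 hfl he₀)
  have h₁₂ : ExactTwoProd p emin fl tp (fl (a₁ - c₁)) (fl (b₂ - c₂)) :=
    htp _ _ (fmt ha₁ hc₁) (fmt hb₂ hc₂)
  have h₃₄ : ExactTwoProd p emin fl tp (fl (a₂ - c₂)) (fl (b₁ - c₁)) :=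
    htp _ _ (fmt ha₂ hc₂) (fmt hb₁ hc₁)
  rcases hA : orient2dStageA fl (ccwerrboundA p) a₁ a₂ b₁ b₂ c₁ c₂ with _ | d
  · rcases hB : orient2dStageB tp fl (ccwerrboundB p) (orient2dDetsum fl a₁ a₂ b₁ b₂ c₁ c₂)
        a₁ a₂ b₁ b₂ c₁ c₂ with _ | d
    · by_cases hT : (a₁ - c₁) - fl (a₁ - c₁) = 0 ∧ (b₂ - c₂) - fl (b₂ - c₂) = 0 ∧
        (a₂ - c₂) - fl (a₂ - c₂) = 0 ∧ (b₁ - c₁) - fl (b₁ - c₁) = 0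
      · -- the tails-zero exit
        rw [orient2dAdapt_of_tailsZero hA hB hT]
        obtain ⟨e1, e2, e3, e4⟩ := hT
        have f1 : fl (a₁ - c₁) = a₁ - c₁ := by linarith
        have f2 : fl (b₂ - c₂) = b₂ - c₂ := by linarith
        have f3 : fl (a₂ - c₂) = a₂ - c₂ := by linarith
        have f4 : fl (b₁ - c₁) = b₁ - c₁ := by linarith
        have hF1 : IsFloat p emin (a₁ - c₁) := by rw [← f1]; exact (hfl _).1
        have hF2 : IsFloat p emin (b₂ - c₂) := by rw [← f2]; exact (hfl _).1
        have hF3 : IsFloat p emin (a₂ - c₂) := by rw [← f3]; exact (hfl _).1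
        have hF4 : IsFloat p emin (b₁ - c₁) := by rw [← f4]; exact (hfl _).1
        rw [f1, f2] at h₁₂
        rw [f3, f4] at h₃₄
        exact orient2d_tailsZero_sign hp1 hfl hfl2 hF1 hF2 hF3 hF4 h₁₂ h₃₄
      · rcases hC : orient2dStageC tp fl (ccwerrboundC p) (resulterrbound p)
            (orient2dDetsum fl a₁ a₂ b₁ b₂ c₁ c₂) a₁ a₂ b₁ b₂ c₁ c₂ with _ | d
        · -- stage D
          rw [orient2dAdapt_of_stageD hA hB hT hC]
          obtain ⟨hD, hpos, hneg, -⟩ :=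
            orient2dExactWith_sign hp hfl hodd hfl2 hfes he₀ htp ha₁ ha₂ hb₁ hb₂ hc₁ hc₂
          rw [List.getLast?_eq_getLast_of_ne_nil hD, Option.getD_some]
          unfold orient2dDet at hpos hneg
          exact ⟨hpos.mpr, hneg.mpr⟩
        · -- stage C
          rw [orient2dAdapt_of_stageC hA hB hT hC]
          have h := orient2dStageC_correct hp hfl hfl2 he₀ h3 ha₁ ha₂ hb₁ hb₂ hc₁ hc₂ h₁₂ h₃₄ hA hC
          exact ⟨h.1.mp, h.2.mp⟩
    · -- stage B
      rw [orient2dAdapt_of_stageB hA hB]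
      have h := orient2dStageB_correct hp hfl hfl2 he₀ h2 ha₁ ha₂ hb₁ hb₂ hc₁ hc₂ h₁₂ h₃₄ hA hB
      exact ⟨h.1.mp, h.2.mp⟩
  · -- stage A
    rw [orient2dAdapt_of_stageA hA]
    have h := orient2dStageA_correct hp hfl he₀ h2 ha₁ ha₂ hb₁ hb₂ hc₁ hc₂ hA
    exact ⟨h.1.mp, h.2.mp⟩

/-- **Corollary: a NONZERO answer decides the sign** — `r > 0 ↔ t_A > 0` and `r < 0 ↔ t_A < 0`. -/
theorem orient2dAdapt_sign_iff (hp : 4 ≤ p) (hfl : IsRoundNearest p emin fl)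
    (hodd : ∀ t, fl (-t) = -fl t) (hfl2 : RoundoffBelow 2 fl)
    {fes : List ℚ → List ℚ → List ℚ} (hfes : FesSpec p emin fes) {e₀ : ℤ} (he₀ : emin ≤ e₀)
    (h3 : emin + 3 * p ≤ e₀ + e₀) {tp : ℚ → ℚ → ℚ × ℚ}
    (htp : ∀ x y, IsFloat p e₀ x → IsFloat p e₀ y → ExactTwoProd p emin fl tp x y)
    {a₁ a₂ b₁ b₂ c₁ c₂ : ℚ} (ha₁ : IsFloat p e₀ a₁) (ha₂ : IsFloat p e₀ a₂) (hb₁ : IsFloat p e₀ b₁)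
    (hb₂ : IsFloat p e₀ b₂) (hc₁ : IsFloat p e₀ c₁) (hc₂ : IsFloat p e₀ c₂)
    (hr : orient2dAdapt fes tp fl (ccwerrboundA p) (ccwerrboundB p) (ccwerrboundC p)
        (resulterrbound p) a₁ a₂ b₁ b₂ c₁ c₂ ≠ 0) :
    (0 < orient2dAdapt fes tp fl (ccwerrboundA p) (ccwerrboundB p) (ccwerrboundC p)
        (resulterrbound p) a₁ a₂ b₁ b₂ c₁ c₂ ↔ 0 < orient2dDet a₁ a₂ b₁ b₂ c₁ c₂) ∧
      (orient2dAdapt fes tp fl (ccwerrboundA p) (ccwerrboundB p) (ccwerrboundC p)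
        (resulterrbound p) a₁ a₂ b₁ b₂ c₁ c₂ < 0 ↔ orient2dDet a₁ a₂ b₁ b₂ c₁ c₂ < 0) := by
  obtain ⟨h1, h2⟩ := orient2dAdapt_sign hp hfl hodd hfl2 hfes he₀ h3 htp ha₁ ha₂ hb₁ hb₂ hc₁ hc₂
  rcases lt_or_gt_of_ne hr with hneg | hpos
  · have := h2 hneg
    exact ⟨⟨fun h => absurd h (not_lt.mpr hneg.le), fun h => absurd h (not_lt.mpr this.le)⟩,
      ⟨fun _ => this, fun _ => hneg⟩⟩
  · have := h1 hpos
    exact ⟨⟨fun _ => this, fun _ => hpos⟩,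
      ⟨fun h => absurd h (not_lt.mpr hpos.le), fun h => absurd h (not_lt.mpr this.le)⟩⟩

/-! ## The instance ties-to-even + FMA two-product + `predicates.c`'s expansion sum -/

/-- **`orient2d` with ties-to-even, `2Prod_FMA` and `fast_expansion_sum_zeroelim`** (the binary64
build of `predicates.c` on FMA hardware, scaled to precision `p ≥ 4`): for coordinates in `F(p, e₀)`
with `emin ≤ e₀` and `emin + 3p ≤ 2e₀`, a positive answer certifies `t_A > 0` and a negative one
`t_A < 0`. -/
theorem orient2dAdapt_fma_sign (hp : 4 ≤ p) {e₀ : ℤ} (he₀ : emin ≤ e₀) (h3 : emin + 3 * p ≤ e₀ + e₀)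
    {a₁ a₂ b₁ b₂ c₁ c₂ : ℚ} (ha₁ : IsFloat p e₀ a₁) (ha₂ : IsFloat p e₀ a₂) (hb₁ : IsFloat p e₀ b₁)
    (hb₂ : IsFloat p e₀ b₂) (hc₁ : IsFloat p e₀ c₁) (hc₂ : IsFloat p e₀ c₂) :
    let r := orient2dAdapt (fastExpansionSumZeroElimC (roundTiesEven p emin))
      (twoProdFMA (roundTiesEven p emin)) (roundTiesEven p emin) (ccwerrboundA p) (ccwerrboundB p)
      (ccwerrboundC p) (resulterrbound p) a₁ a₂ b₁ b₂ c₁ c₂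
    (0 < r → 0 < orient2dDet a₁ a₂ b₁ b₂ c₁ c₂) ∧ (r < 0 → orient2dDet a₁ a₂ b₁ b₂ c₁ c₂ < 0) := by
  intro r
  have hp1 : 1 ≤ p := le_trans (by norm_num) hp
  have h2 : emin ≤ e₀ + e₀ := by omega
  have hfl : IsRoundNearest p emin (roundTiesEven p emin) := isRoundNearest_roundTiesEven hp1
  have hodd : ∀ t, roundTiesEven p emin (-t) = -roundTiesEven p emin t :=
    Literature.ComputerArithmetic.GraillatMuller2025.roundTiesEven_neg
  have hfl2 : RoundoffBelow 2 (roundTiesEven p emin) := roundoffBelow_two_roundTiesEven p emin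
  have hfes := fesSpec_fastExpansionSumZeroElimC hp hfl hfl2
  have htp : ∀ x y, IsFloat p e₀ x → IsFloat p e₀ y →
      ExactTwoProd p emin (roundTiesEven p emin) (twoProdFMA (roundTiesEven p emin)) x y :=
    fun x y hx hy => exactTwoProd_twoProdFMA hp1 hfl h2 hx hy
  exact orient2dAdapt_sign hp hfl hodd hfl2 hfes he₀ h3 htp ha₁ ha₂ hb₁ hb₂ hc₁ hc₂

end Summit.Ventures.CertifiedArithmetic.Expansions
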